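import Literature.MathematicalPhysics.QuantumFieldTheory.Balaban1983to89.B15Prop1RealChartFamilyFromMinimiserChart
import Literature.MathematicalPhysics.QuantumFieldTheory.Balaban1983to89.B15Prop1GaugeRetractionOfGaugeSection
import Literature.MathematicalPhysics.QuantumFieldTheory.Balaban1983to89.B15Eq177ValueInvarianceCoDiv
import Literature.MathematicalPhysics.QuantumFieldTheory.Balaban1983to89.Node00.WilsonActionSecondVariationGauge
import Literature.MathematicalPhysics.QuantumFieldTheory.Balaban1983to89.B16Eq150VariableFields

/-!
# `Balaban1983to89.B15Prop1RealChartFamilyGaugeTransport` — [Balaban1985Variational] = «[15]», (3)–(4) p. 278 (the residual gauge group of the constraints), (15) p. 280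
# («U = U′U₀»), (181) p. 307 («U_k(V^v) = U_k(V)^{v̄}» — minimal configurations move with the gauge), Prop. 9 (190) p. 309; [Balaban1985BackgroundPropagators], (3.29) p. 395
# («R(u) exp iηA = exp iηR(u)A R(u)»); [Balaban1989LargeFieldII] = «[LF-II]», p. 357 («doing a proper gauge transformation we represent it … as exp iξA₀»; «the compensating adjoint
# gauge transformation on the variables B′»), p. 358 («holds for U₀ in an arbitrary gauge»); [Balaban1988Convergent] = «[III]», (2.10)–(2.12) p. 256:
# ★★ THE RESIDUAL-GAUGE TRANSPORT OF THE REAL CHART FAMILY (K′) — THE PACKAGE `(U₀, X_f)` FOLLOWS `U₀ ↦ U₀^σ` WITH THE COMPENSATING ADJOINT ACTION `X_f ↦ Ad_{σ(b₊)} X_f`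

Honest framing: statement-level skeleton of published theorems with citation tags; proofs where landed; nothing here is a claim about the
Yang–Mills mass gap.  Cell `pub-ymgap`, HUMAN RULING D-0154 (R399 (3a) width seats), seat `pub-ymgap-dag-n12-w5` (g3; N12 = [B15], own lineage (K′) =
`B15Prop1RealChartFamilyFromMinimiserChart` p608072, (K) = `B15Prop1RealChartFamilyVelocity` p613674); count-neutral helper of K1⁷ (`stmt-QuantumFields-20542`); N12 NOT
discharged; finite 𝕋⁴ at fixed ε; nothing continuum ∕ OS ∕ mass-gap ∕ Clay.

WHY.  The assembled endpoint of the N12∕s1 lane (`B15Prop1EndpointNearFlatLetters`) wants, per instance and base field, ONE configuration `U₀` carrying BOTH a bond-wise `A₀`-gauge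
letter (near-flatness, in its localised v1.2 form on a neighbourhood of `Ω₁(Z)`) AND the (K′) family `Y ↦ expChart U₀ (X_f Y)` of (2.12) minimisers with its regularity, velocity
bound (K) and support letters.  (K′) delivers the family at the UN-gauged base minimiser `U₀ := Ũ(0,0)` of the (J0′) chart; near-flatness inside `Ω₁(Z)` is available only for a
representative `U₀^σ` in a residual block-axial gauge (the dag-n12-w6 lineage: `σ` trivial on the block towers under the endpoints of the bonds of `𝐁_k(Z)`, so that the constrained
averages do not move — `B15Prop1GaugeRetractionOfGaugeSection.agreeOn_gaugeAct_of_residual`, [15] (3)–(4)).  THIS MODULE is the glue: the whole package follows `U₀ ↦ U₀^σ`.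
Mechanism ([15] (181) at the level of minimal SETS; [B-Prop] (3.29)): with the compensating adjoint action `(Ad_σ X)(b) := σ(b₊)·X(b)·σ(b₊)⁻¹` one has
`expChart (U₀^σ) (Ad_σ X) = (expChart U₀ X)^σ` (dag-n12-w2's `Node00.WilsonActionSecondVariationGauge.expChart_gaugeAct`); the class of record is gauge invariant ([15] p. 278 l. 8–9,
`B15Eq177ValueInvarianceCoDiv.gaugeAct_mem_regMSCoPOfRecord`), the Wilson action is invariant, and a residual `σ` fixes the constrained averages — so every member of the transported
family is again a (2.12) minimiser of the SAME datum; `X ↦ Ad_σ X` is a continuous linear automorphism of the bond-field space, bond-wise an isometry for the Hilbert–Schmidt and the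
`L²`-operator norms, so `X_f 0 = 0`, `Cⁿ` at `0`, the velocity bounds (K) and the support letter transfer VERBATIM, with `D(Ad_σ∘X_f)(0)X (b) = Ad_{σ(b₊)}(DX_f(0)X (b))`.

CONTENTS (theorems only; no `def`, no `instance`, no `sorry`; the transported family is written as the lambda `fun Y b => specialUnitaryAd (σ b.tgt) (X_f Y b)`).
* §1 ★ `isMinimizer_gaugeAct_of_agreeOn` (ANY group ∕ averaging ∕ class: a minimiser stays a minimiser of the SAME datum under a class-preserving gauge
  transformation that fixes its constrained averages).
* §2 `exists_adBondCLE` (the compensating adjoint action is a continuous linear automorphism `L` of `bonds → 𝔰𝔲(N)` with `L X b = Ad_{σ(b₊)} X_b`), `adBond_zero`, `contDiffAt_adBond_comp`,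
  ★ `fderiv_adBond_comp_apply` (velocity formula, no differentiability hypothesis), `norm_fderiv_adBond_comp_apply` (Hilbert–Schmidt), `norm_coe_fderiv_adBond_comp_apply` (`L²`-operator),
  `adBond_comp_apply_eq_zero_iff` (support).
* §3 ★★ `realChartFamily_gaugeAct` — generic `SU(N)`, any `av`, `reg`, `𝔹`, data family: class invariance + residual letter + the (K′) triple ⊢ the (K′) triple for `(U₀^σ, Ad_σ X_f)`.
* §4 ★★★ `realChartFamily_gaugeAct_atRecord` — at the endpoint's objects VERBATIM (`Node00.avOfRecord F 2 Kt`, `Node00.regMSCoPOfRecord F 2 ν Kt k (maxDomT ν.M₁ Z)`, `Bj ν.M₁ Z k`, slice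
  `GaugeSlice (pts k Λ) T E3`, base field `ext Ṽ_k`, `k ≤ m + K`): `hNF`'s conjuncts «`X_f 0 = 0`, `ContDiffAt ℝ 2 X_f 0`, `hmin`» for `(U₀, X_f)` and dag-n12-w6's root letter `hu` for `σ`
  ⊢ the same three conjuncts for `(σ • U₀, Ad_σ X_f)` ∧ for all `X`, `b`: the velocity formula, both norm equalities, and the support equivalence.
HONEST SCOPE: group bookkeeping and finite-dimensional calculus over landed theorems; `σ` and its root letter are HYPOTHESES (producer: the dag-n12-w6 lineage's forest gauge,
`B15Prop1AxialGaugeSectionOfForest`); no near-flatness is proved here; nothing of Bałaban's estimates is asserted; N12 NOT discharged; K1⁷ NOT closed.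
-/

noncomputable section

open Set Metric Filter
open scoped Topology Matrix.Norms.L2Operator

namespace Literature.MathematicalPhysics.QuantumFieldTheory.Balaban1983to89.B15Prop1RealChartFamilyGaugeTransport

open B15Prop1SliceCoordinates (GaugeSlice ιA)
open B15Prop1ChartCalculusSU2 (E3)
open B15Prop1ChartSU2 (su2Chart)
open T4CubeChartGnomonic (SU2)
open T4Continuum B15DeterminingSets GaugeField
open T4AdjointCovarianceUnitary (lieSU expSU coe_expSU specialUnitaryAd norm_specialUnitaryAd)
open Node00 (expChart expChart_zero SU expChart_gaugeAct norm_coe_specialUnitaryAd)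
open B14.Eq213DetSet B14.Eq216Concrete
open B16Sect1Backgrounds (expMul toMS)
open B15Prop1GaugeRetractionOfGaugeSection (agreeOn_gaugeAct_of_residual)
open B15Eq177ValueInvarianceCoDiv (gaugeAct_mem_regMSCoPOfRecord)
open Literature.MathematicalPhysics.QuantumFieldTheory.BalabanImbrieJaffe1984to88.BIJ85Eq453GaugeField (qsstarGIter0)

/-! ## §1  A class-preserving gauge transformation fixing the constrained averages carries minimisers to minimisers of the same datum -/

section Minimiser

variable {P : Params} {G : Type*} [GaugeGroup G]

/-- ★ **RESIDUAL TRANSPORT OF (2.12) MINIMISERS**: if `U₀` is a minimal configuration for the datum `V` on `𝔹` in the class `reg`, and the gauge transformation `σ` keeps `U₀` in the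
class (`hreg`) and does not move its constrained averages (`hfix`: `M_𝔹(U₀^σ) = M_𝔹(U₀)` — [15] (3)–(4): the residual group of the constraints), then `U₀^σ` is a minimal configuration
for the SAME datum — `A(U₀^σ) = A(U₀)`.  The mechanism of [15] (181) at the level of minimal sets; nothing about uniqueness.
[cite: Balaban1985Variational, (3)–(4) p.278, (181) p.307; Balaban1988Convergent, (2.12) p.256] -/
theorem isMinimizer_gaugeAct_of_agreeOn (av : ∀ j, Averaging P j G) {reg : Set (GaugeField P 0 G)} {𝔹 : DetSet P} {V : MSField P G}
    {U₀ : GaugeField P 0 G} (σ : GaugeTransf P 0 G) (hreg : gaugeAct σ U₀ ∈ reg)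
    (hfix : AgreeOn 𝔹 (avgFamily av (gaugeAct σ U₀)) (avgFamily av U₀)) (h : IsMinimizer av reg 𝔹 V U₀) :
    IsMinimizer av reg 𝔹 V (gaugeAct σ U₀) := by
  refine ⟨hreg, B16Eq150VariableFields.agreeOn_trans hfix h.2.1, fun U hU hUV => ?_⟩
  rw [B14Eq16FaddeevPopov.wilsonAction4_gaugeAct']
  exact h.2.2 U hU hUV

end Minimiser

/-! ## §2  The compensating adjoint action on bond fields: a continuous linear automorphism, bond-wise isometric -/

section AdBond

variable {P : Params} {j : ℕ} {N : ℕ}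

/-- **THE COMPENSATING ADJOINT ACTION IS A CONTINUOUS LINEAR AUTOMORPHISM** of the bond-field space `bonds → 𝔰𝔲(N)`: `L X (b) = σ(b₊)·X(b)·σ(b₊)⁻¹` (bond-wise the linear isometry
`specialUnitaryAd (σ b₊)`, assembled by `ContinuousLinearEquiv.piCongrRight`). [cite: Balaban1985BackgroundPropagators, (3.29) p.395; Balaban1989LargeFieldII, p.357 («the compensating adjoint gauge transformation on the variables B′»)] -/
theorem exists_adBondCLE (σ : GaugeTransf P j (SU N)) :
    ∃ L : (PBond P j → lieSU (Fin N)) ≃L[ℝ] (PBond P j → lieSU (Fin N)), ∀ X b, L X b = specialUnitaryAd (σ b.tgt) (X b) :=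
  ⟨ContinuousLinearEquiv.piCongrRight fun b => (specialUnitaryAd (σ b.tgt)).toContinuousLinearEquiv, fun _ _ => rfl⟩

/-- The compensating action fixes the origin: `Ad_σ 0 = 0`. [cite: Balaban1985BackgroundPropagators, (3.29) p.395 (bookkeeping)] -/
theorem adBond_zero (σ : GaugeTransf P j (SU N)) : (fun b : PBond P j => specialUnitaryAd (σ b.tgt) ((0 : PBond P j → lieSU (Fin N)) b)) = 0 := by
  funext b
  simp only [Pi.zero_apply, map_zero]

/-- **SUPPORT IS PRESERVED**: `Ad_{σ(b₊)} (X b) = 0 ↔ X b = 0`. [cite: Balaban1985BackgroundPropagators, (3.29) p.395 (bookkeeping)] -/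
theorem adBond_apply_eq_zero_iff (σ : GaugeTransf P j (SU N)) (X : PBond P j → lieSU (Fin N)) (b : PBond P j) :
    specialUnitaryAd (σ b.tgt) (X b) = 0 ↔ X b = 0 :=
  (specialUnitaryAd (σ b.tgt)).map_eq_zero_iff

variable {G' : Type*} [NormedAddCommGroup G'] [NormedSpace ℝ G']

/-- **REGULARITY IS PRESERVED**: if `X_f` is `Cⁿ` at a point so is `Y ↦ Ad_σ (X_f Y)` (composition with a continuous linear map). [cite: Balaban1985Variational, Prop. 9 (190) p.309 (bookkeeping); Balaban1985BackgroundPropagators, (3.29) p.395] -/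
theorem contDiffAt_adBond_comp (σ : GaugeTransf P j (SU N)) {Xf : G' → PBond P j → lieSU (Fin N)} {n : WithTop ℕ∞} {Y₀ : G'}
    (h : ContDiffAt ℝ n Xf Y₀) : ContDiffAt ℝ n (fun Y b => specialUnitaryAd (σ b.tgt) (Xf Y b)) Y₀ := by
  obtain ⟨L, hL⟩ := exists_adBondCLE σ
  have hfun : (fun Y b => specialUnitaryAd (σ b.tgt) (Xf Y b)) = L ∘ Xf := by
    funext Y b
    exact (hL (Xf Y) b).symm
  rw [hfun]
  exact L.contDiff.comp_contDiffAt Y₀ h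

/-- ★ **THE VELOCITY FORMULA**: `D(Ad_σ ∘ X_f)(Y₀) X (b) = Ad_{σ(b₊)} (DX_f(Y₀) X (b))` — unconditionally (`ContinuousLinearEquiv.comp_fderiv`: both sides vanish when `X_f` is not
differentiable). [cite: Balaban1985BackgroundPropagators, (3.29) p.395; Balaban1989LargeFieldII, p.357] -/
theorem fderiv_adBond_comp_apply (σ : GaugeTransf P j (SU N)) (Xf : G' → PBond P j → lieSU (Fin N)) (Y₀ X : G') (b : PBond P j) :
    fderiv ℝ (fun Y b => specialUnitaryAd (σ b.tgt) (Xf Y b)) Y₀ X b = specialUnitaryAd (σ b.tgt) (fderiv ℝ Xf Y₀ X b) := by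
  obtain ⟨L, hL⟩ := exists_adBondCLE σ
  have hfun : (fun Y b => specialUnitaryAd (σ b.tgt) (Xf Y b)) = L ∘ Xf := by
    funext Y b
    exact (hL (Xf Y) b).symm
  rw [hfun]
  have key : fderiv ℝ (⇑L ∘ Xf) Y₀ = (L : (PBond P j → lieSU (Fin N)) →L[ℝ] (PBond P j → lieSU (Fin N))).comp (fderiv ℝ Xf Y₀) :=
    L.comp_fderiv
  have key' : fderiv ℝ (⇑L ∘ Xf) Y₀ X b
      = ((L : (PBond P j → lieSU (Fin N)) →L[ℝ] (PBond P j → lieSU (Fin N))).comp (fderiv ℝ Xf Y₀)) X b :=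
    congrArg (fun M : G' →L[ℝ] (PBond P j → lieSU (Fin N)) => M X b) key
  exact key'.trans (hL _ _)

/-- **THE HILBERT–SCHMIDT SIZE OF THE VELOCITY IS PRESERVED** bond-wise: `‖D(Ad_σ∘X_f)(Y₀)X (b)‖ = ‖DX_f(Y₀)X (b)‖`. [cite: Balaban1985Averaging, (17) p.21; Balaban1985BackgroundPropagators, (3.29) p.395] -/
theorem norm_fderiv_adBond_comp_apply (σ : GaugeTransf P j (SU N)) (Xf : G' → PBond P j → lieSU (Fin N)) (Y₀ X : G') (b : PBond P j) :
    ‖fderiv ℝ (fun Y b => specialUnitaryAd (σ b.tgt) (Xf Y b)) Y₀ X b‖ = ‖fderiv ℝ Xf Y₀ X b‖ := by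
  rw [fderiv_adBond_comp_apply, norm_specialUnitaryAd]

/-- **THE `L²`-OPERATOR SIZE OF THE VELOCITY IS PRESERVED** bond-wise (unitary invariance of the C⋆-norm, dag-n12-w2's `norm_coe_specialUnitaryAd`). [cite: Balaban1985Averaging, (19) p.21; Balaban1985BackgroundPropagators, (3.29) p.395] -/
theorem norm_coe_fderiv_adBond_comp_apply [NeZero N] (σ : GaugeTransf P j (SU N)) (Xf : G' → PBond P j → lieSU (Fin N)) (Y₀ X : G') (b : PBond P j) :
    ‖((fderiv ℝ (fun Y b => specialUnitaryAd (σ b.tgt) (Xf Y b)) Y₀ X b : lieSU (Fin N)) : Matrix (Fin N) (Fin N) ℂ)‖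
      = ‖((fderiv ℝ Xf Y₀ X b : lieSU (Fin N)) : Matrix (Fin N) (Fin N) ℂ)‖ := by
  rw [fderiv_adBond_comp_apply, norm_coe_specialUnitaryAd]

omit [NormedAddCommGroup G'] [NormedSpace ℝ G'] in
/-- Support of the transported family: `Ad_σ (X_f Y) (b) = 0 ↔ X_f Y (b) = 0`. [cite: Balaban1985BackgroundPropagators, (3.29) p.395 (bookkeeping)] -/
theorem adBond_comp_apply_eq_zero_iff (σ : GaugeTransf P j (SU N)) (Xf : G' → PBond P j → lieSU (Fin N)) (Y : G') (b : PBond P j) :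
    specialUnitaryAd (σ b.tgt) (Xf Y b) = 0 ↔ Xf Y b = 0 :=
  adBond_apply_eq_zero_iff σ (Xf Y) b

end AdBond

/-! ## §3  The (K′) triple follows `U₀ ↦ U₀^σ` -/

section Transport

variable {P : Params} {N : ℕ} [NeZero N] {G' : Type*} [NormedAddCommGroup G'] [NormedSpace ℝ G']

/-- ★★ **RESIDUAL-GAUGE TRANSPORT OF THE REAL CHART FAMILY (generic).**  Let `reg` be invariant under the gauge transformation `σ` (`hreg`) and let `σ` fix the `𝔹`-averages of EVERY
configuration (`hres` — the residual group of the constraints, [15] (3)–(4); producer: `agreeOn_gaugeAct_of_residual` from the root letter).  If `X_f 0 = 0`, `X_f` is `Cⁿ` at `0`, and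
`expChart U₀ (X_f Y)` is, for `Y` near `0`, a (2.12) minimiser in `reg` of the datum `V Y` on `𝔹`, then the transported pair `(U₀^σ, Y ↦ Ad_σ (X_f Y))` has the same three properties
for the SAME data: `expChart (U₀^σ) (Ad_σ X) = (expChart U₀ X)^σ` (dag-n12-w2's `expChart_gaugeAct`) and §1.
[cite: Balaban1985Variational, (3)–(4) p.278, (15) p.280, (181) p.307, Prop. 9 (190) p.309; Balaban1985BackgroundPropagators, (3.29) p.395; Balaban1989LargeFieldII, p.357, p.358; Balaban1988Convergent, (2.12) p.256] -/
theorem realChartFamily_gaugeAct (av : ∀ j, Averaging P j (SU N)) (reg : Set (GaugeField P 0 (SU N))) (𝔹 : DetSet P) (σ : GaugeTransf P 0 (SU N))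
    (hreg : ∀ U, U ∈ reg → gaugeAct σ U ∈ reg) (hres : ∀ U : GaugeField P 0 (SU N), AgreeOn 𝔹 (avgFamily av (gaugeAct σ U)) (avgFamily av U))
    (V : G' → MSField P (SU N)) (U₀ : GaugeField P 0 (SU N)) (Xf : G' → PBond P 0 → lieSU (Fin N)) {n : WithTop ℕ∞}
    (hX₀ : Xf 0 = 0) (hXc : ContDiffAt ℝ n Xf 0) (hmin : ∀ᶠ Y in 𝓝 (0 : G'), IsMinimizer av reg 𝔹 (V Y) (expChart U₀ (Xf Y))) :
    (fun b : PBond P 0 => specialUnitaryAd (σ b.tgt) (Xf 0 b)) = 0 ∧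
      ContDiffAt ℝ n (fun Y b => specialUnitaryAd (σ b.tgt) (Xf Y b)) 0 ∧
      ∀ᶠ Y in 𝓝 (0 : G'), IsMinimizer av reg 𝔹 (V Y) (expChart (gaugeAct σ U₀) (fun b => specialUnitaryAd (σ b.tgt) (Xf Y b))) := by
  refine ⟨?_, contDiffAt_adBond_comp σ hXc, ?_⟩
  · rw [hX₀]
    exact adBond_zero σ
  · filter_upwards [hmin] with Y hY
    rw [expChart_gaugeAct σ U₀ (Xf Y)]
    exact isMinimizer_gaugeAct_of_agreeOn av σ (hreg _ hY.1) (hres _) hY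

end Transport

/-! ## §4  At the endpoint's objects: `hNF`'s family conjuncts follow the residual block-axial gauge -/

section AtRecord

variable {F : T4Family}

/-- ★★★ **THE (K′) PACKAGE AT THE ENDPOINT'S OBJECTS FOLLOWS THE RESIDUAL GAUGE.**  At one Prop-1 instance of `B15Prop1EndpointNearFlatLetters.…_ofNearFlatLetters[_sub]_oneSided` (averaging
`Node00.avOfRecord F 2 Kt`, class `Node00.regMSCoPOfRecord F 2 ν Kt k (maxDomT ν.M₁ Z)`, determining set `𝐁_k(Z) = Bj ν.M₁ Z k`, slice `GaugeSlice (pts k Λ) T E3`, base field `ext Ṽ_k`,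
`k ≤ m + K`): let `(U₀, X_f)` satisfy `hNF`'s family conjuncts — `X_f 0 = 0`, `ContDiffAt ℝ 2 X_f 0`, `hmin` — and let `σ` be a residual gauge transformation of the constraints in the
dag-n12-w6 lineage's currency (`hu`: trivial on the block towers under the endpoints of the bonds of `𝐁_k(Z)`, levels `≤ k`).  Then `(σ • U₀, Y ↦ Ad_σ (X_f Y))` satisfies the same three
conjuncts for the SAME data (class invariance: `B15Eq177ValueInvarianceCoDiv.gaugeAct_mem_regMSCoPOfRecord`; averages: `agreeOn_gaugeAct_of_residual`), and for every slice vector `X`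
and bond `b`: the velocity is `Ad_{σ(b₊)}` of the old one, with the same Hilbert–Schmidt and `L²`-operator sizes (so (K) — `B15Prop1RealChartFamilyVelocity` — transfers verbatim), and
the transported coordinates vanish exactly where the old ones do (so the support letter — `B15Prop1RealChartFamilySupport` — transfers verbatim).  `σ` is a HYPOTHESIS; no near-flatness
is proved here. [cite: Balaban1985Variational, (3)–(4) p.278, (15) p.280, (181) p.307, Prop. 9 (190) p.309; Balaban1989LargeFieldII, p.357, p.358, (1.12) p.359; Balaban1989LargeFieldI, (1.74) p.192, Prop. 1 p.194 (last clause); Balaban1988Convergent, (2.10)–(2.13) pp.256–257; Balaban1985BackgroundPropagators, (3.29) p.395] -/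
theorem realChartFamily_gaugeAct_atRecord (ν : Node00.Stage7Numerics) (Kt : ℕ) {k : ℕ} (hk : k ≤ (F.P Kt).m + (F.P Kt).K)
    (Z Λ : Set (Site (F.P Kt) 0)) (T : Finset (PBond (F.P Kt) k))
    (ext : GaugeField (F.P Kt) k SU2 → GaugeField (F.P Kt) k SU2) (Vk : GaugeField (F.P Kt) k SU2)
    (σ : GaugeTransf (F.P Kt) 0 SU2)
    (hu : ∀ j, j ≤ k → ∀ b ∈ bondsOf (Bj ν.M₁ Z k j), toMS σ j b.src = 1 ∧ toMS σ j b.tgt = 1)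
    (U₀ : GaugeField (F.P Kt) 0 SU2) (Xf : GaugeSlice (pts k Λ) T E3 → PBond (F.P Kt) 0 → lieSU (Fin 2)) (hX₀ : Xf 0 = 0) (hXc : ContDiffAt ℝ 2 Xf 0)
    (hmin : ∀ᶠ Y in 𝓝 (0 : GaugeSlice (pts k Λ) T E3),
      IsMinimizer (Node00.avOfRecord F 2 Kt) (Node00.regMSCoPOfRecord F 2 ν Kt k (maxDomT ν.M₁ Z)) (Bj ν.M₁ Z k)
        (avgFamily (Node00.avOfRecord F 2 Kt) (qsstarGIter0 k (expMul su2Chart (ιA (pts k Λ) T Y) (ext Vk)))) (expChart U₀ (Xf Y))) :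
    (fun b : PBond (F.P Kt) 0 => specialUnitaryAd (σ b.tgt) (Xf 0 b)) = 0 ∧
      ContDiffAt ℝ 2 (fun Y b => specialUnitaryAd (σ b.tgt) (Xf Y b)) 0 ∧
      (∀ᶠ Y in 𝓝 (0 : GaugeSlice (pts k Λ) T E3),
        IsMinimizer (Node00.avOfRecord F 2 Kt) (Node00.regMSCoPOfRecord F 2 ν Kt k (maxDomT ν.M₁ Z)) (Bj ν.M₁ Z k)
          (avgFamily (Node00.avOfRecord F 2 Kt) (qsstarGIter0 k (expMul su2Chart (ιA (pts k Λ) T Y) (ext Vk))))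
          (expChart (gaugeAct σ U₀) (fun b => specialUnitaryAd (σ b.tgt) (Xf Y b)))) ∧
      ∀ (X : GaugeSlice (pts k Λ) T E3) (b : PBond (F.P Kt) 0),
        fderiv ℝ (fun Y b => specialUnitaryAd (σ b.tgt) (Xf Y b)) 0 X b = specialUnitaryAd (σ b.tgt) (fderiv ℝ Xf 0 X b) ∧
        ‖fderiv ℝ (fun Y b => specialUnitaryAd (σ b.tgt) (Xf Y b)) 0 X b‖ = ‖fderiv ℝ Xf 0 X b‖ ∧
        ‖((fderiv ℝ (fun Y b => specialUnitaryAd (σ b.tgt) (Xf Y b)) 0 X b : lieSU (Fin 2)) : Matrix (Fin 2) (Fin 2) ℂ)‖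
          = ‖((fderiv ℝ Xf 0 X b : lieSU (Fin 2)) : Matrix (Fin 2) (Fin 2) ℂ)‖ ∧
        (∀ Y : GaugeSlice (pts k Λ) T E3, specialUnitaryAd (σ b.tgt) (Xf Y b) = 0 ↔ Xf Y b = 0) := by
  have hres : ∀ U : GaugeField (F.P Kt) 0 SU2,
      AgreeOn (Bj ν.M₁ Z k) (avgFamily (Node00.avOfRecord F 2 Kt) (gaugeAct σ U)) (avgFamily (Node00.avOfRecord F 2 Kt) U) :=
    fun U => agreeOn_gaugeAct_of_residual (Node00.avOfRecord F 2 Kt) (Bj ν.M₁ Z k) hk (fun j hj => Bj_of_gt hj) hu U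
  have hreg : ∀ U, U ∈ Node00.regMSCoPOfRecord F 2 ν Kt k (maxDomT ν.M₁ Z) →
      gaugeAct σ U ∈ Node00.regMSCoPOfRecord F 2 ν Kt k (maxDomT ν.M₁ Z) :=
    fun U hU => gaugeAct_mem_regMSCoPOfRecord ν Kt k (maxDomT ν.M₁ Z) σ U hU
  obtain ⟨h0, hc, hm⟩ := realChartFamily_gaugeAct (Node00.avOfRecord F 2 Kt) (Node00.regMSCoPOfRecord F 2 ν Kt k (maxDomT ν.M₁ Z)) (Bj ν.M₁ Z k) σ
    hreg hres (fun Y => avgFamily (Node00.avOfRecord F 2 Kt) (qsstarGIter0 k (expMul su2Chart (ιA (pts k Λ) T Y) (ext Vk)))) U₀ Xf hX₀ hXc hmin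
  refine ⟨h0, hc, hm, fun X b => ⟨fderiv_adBond_comp_apply σ Xf 0 X b, norm_fderiv_adBond_comp_apply σ Xf 0 X b,
    norm_coe_fderiv_adBond_comp_apply σ Xf 0 X b, fun Y => adBond_comp_apply_eq_zero_iff σ Xf Y b⟩⟩

end AtRecord

end Literature.MathematicalPhysics.QuantumFieldTheory.Balaban1983to89.B15Prop1RealChartFamilyGaugeTransport

end
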